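import Summits.CriticalPhenomena.PercolationContinuityZ3.Theorems.PercNearOneGluingNoHeavyQuantLightSliceResidual
import HarnessLib

/-!
# QUANT lane R8, T-DEC: `LightSliceLowCrossBelow` — what is left of the low-cross residue of `LightSliceCore` after the crossed class with the
# lower cross cell a giant became a theorem (census-2 g59; the assembly is `…QuantLightSliceLowCrossSplit`)

builds on p205010 (kernel theorem, internal audit signed; external expert review pending)

Statement file (`--supports stmt-CriticalPhenomena-4575`), QUANT lane seat prim-quant-census-2 (gen 59), rung R8 of
`run/shared/lean/prim/quant/LADDER.md`.  One `@[conjecture]` definition; standard axioms, no sorries.  Memo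
`run/shared/lean/prim/quant/prim-quant-census-2-g59/ASSEMBLY-G59.md` §5.

`LawDec.LightSliceLowCross` (p329232) splits on the lower cross cell `l₁′ + h₂` of the light ⊗ expensive piece: if it is a GIANT
(`j + 1 ≤ l₁′ + h₂`, crossed Type II only) the light slice is DEC by `lightSlice_decAtT_lowCross_crossGiant` (`…QuantLightSliceLowCrossGiant`,
census-2 g59: single-mid knapsack + balance identity + a 25-term Handelman certificate); the statement below is the OTHER case `l₁′ + h₂ ≤ j`
(every Type I pair — census-1 g22's pattern LLG, 86 791 instances at M ≤ 8 — and the crossed Type II pairs with two mids `l₁′ + h₂′`, `l₁′ + h₂`,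
3 885 instances at M ≤ 8; exact census kit j162002 / j163808, 0 light-slice failures).
* `LawDec.LightSliceLowCrossBelow` (`@[conjecture]`) — binder of `LightSliceLowCross` + `l₁′ + h₂ ≤ j`.
`…QuantLightSliceLowCrossSplit`: `LightSliceLowCrossBelow → LightSliceLowCross`, hence
`FarTreeRow ⟸ LightSliceLowCrossBelow ∧ LightSliceWide ∧ (III)`.

[this work]; nothing here is cited as a published result.  The gluing rows served [cite: KozmaNitzan2024, Conjecture 3 (p. 15)]; product
measure [cite: Grimmett1999, §1.3 p. 10].
-/

noncomputable section

namespace Summit.CriticalPhenomena.PercolationContinuityZ3.Theorems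

namespace Quant

open Finset

/-- the two-point law `{lo, hi; g}` (as in `…QuantLawDEC`) -/
local notation3 "TP[" lo ", " hi ", " g ", " h "]" =>
  (g : ℝ) * (if (h : ℕ) = (hi : ℕ) then (1 : ℝ) else 0) + (1 - (g : ℝ)) * (if (h : ℕ) = (lo : ℕ) then (1 : ℝ) else 0)

namespace LawDec

/-- **CONJECTURE LIGHT-SLICE CORE, LOW-CROSS RESIDUE BELOW THE GIANT LINE (census-2 g59).**  In the binder of `LawDec.LightSliceLowCross`
(ordered admissible atom data on both sides, window-DEC, not `BDECAtT`, doubly deep, ¬A2 on side 1, tie-break, top cell of the light ⊗ cheap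
piece a giant, its upper cross cell a conv-low), suppose moreover that the lower cross cell of the light ⊗ expensive piece is NOT a giant
(`l₁′ + h₂ ≤ j`; automatic for Type I atoms `h₂′ = h₂`).  Then the light slice of side 1 is DEC at `(T₁ + T₂, j)`.  The complementary case
`j + 1 ≤ l₁′ + h₂` is the theorem `lightSlice_decAtT_lowCross_crossGiant`.  EVIDENCE: every literal test of `LightSliceCore` (0 failures);
single-mid knapsack certifies all Type I instances and all but 185 of the crossed ones at M ≤ 8 (kit j163808). [this work] [status: open] -/
@[conjecture] def LightSliceLowCrossBelow : Prop :=
  ∀ (x T₁ T₂ : ℝ) (M₁ M₂ j : ℕ) (l₁ h₁ l₁' h₁' l₂ h₂ l₂' h₂' : ℕ),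
    0 < x → x < 1 → j < M₁ + M₂ →
    AtomData x T₁ j M₁ l₁ h₁ l₁' h₁' → AtomData x T₂ j M₂ l₂ h₂ l₂' h₂' →
    l₁ < l₁' → h₁' ≤ h₁ → l₂ < l₂' → h₂' ≤ h₂ →
    (∀ j'', j'' ≤ j → j ≤ j'' + M₂ → DECAtT x T₁ j'' M₁ (atomLaw x T₁ j l₁ h₁ l₁' h₁')) →
    (∀ j'', j'' ≤ j → j ≤ j'' + M₁ → DECAtT x T₂ j'' M₂ (atomLaw x T₂ j l₂ h₂ l₂' h₂')) →
    ¬ BDECAtT x T₁ j M₁ M₂ (atomLaw x T₁ j l₁ h₁ l₁' h₁') → ¬ BDECAtT x T₂ j M₂ M₁ (atomLaw x T₂ j l₂ h₂ l₂' h₂') →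
    l₁' + h₂' ≤ j → l₂' + h₁' ≤ j →
    T₁ + T₂ ≤ 2 * ((l₁' : ℝ) + h₂') →
    h₁' + l₂' ≤ h₂' + l₁' →
    j + 1 ≤ h₁' + h₂' →
    2 * ((h₁' : ℝ) + l₂') < T₁ + T₂ →
    l₁' + h₂ ≤ j →
    DECAtT x (T₁ + T₂) j (M₁ + M₂)
      (lconv M₁ M₂ (fun b => TP[l₁', h₁', gateOf x T₁ j l₁' h₁', b]) (atomLaw x T₂ j l₂ h₂ l₂' h₂'))

end LawDec

end Quant

end Summit.CriticalPhenomena.PercolationContinuityZ3.Theorems
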